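import Mathlib.Analysis.SpecialFunctions.Trigonometric.Bounds
import Mathlib.Analysis.SpecialFunctions.Log.Deriv
import Mathlib.Analysis.SpecialFunctions.Complex.Log
import Mathlib.Analysis.SpecialFunctions.Complex.Arg
import Summits.RiemannHypothesis.RiemannHypothesis.Theorems.JensenPolynomialsFarGumbelDefs

/-!
# Route `JensenPolynomials`, FAR crux `XiWindowZeroFreeRelFar` (B1-rel far), stub S3 `stub_laplaceFar` — WANTED (L0):
the box of the explicit approximate saddle `ξ₀(w, ε)` (RH-FREE; cell rh-jensen, HUMAN RULING D-0040 / D-0074)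

LINE 1 (D-0074 framing): RH-FREE elementary complex analysis of two explicit numbers; nothing here bears on the zeros of `ζ`
or is progress toward RH.

`wanted_xi0_box` is item (L0) of eng-4 g3's S3 WANTED list (HOME `eng-4/S3/S3-WANTED.lean`, sha16 `2a29e604821a401c`),
NAME AND SIGNATURE VERBATIM, one of the six hypotheses of the landed closer `FarGumbel.laplaceFar_of_wanted`
(`Theorems/JensenPolynomialsFarGumbelCloser.lean`, p452276): for `‖z‖ ≤ 9/25` and `0 < ε ≤ 20/189`, with `w = farW z = (1+z)⁻¹`
and `ξ₀ = farXi0 w ε = Log w · (1 + ε(1/4 − w/2))`,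

  `|Im ξ₀| ≤ 39/100` and `|Re ξ₀| ≤ 1/2`

(blueprint values `0.3683` / `0.4463`; consequence in the closer: contour height `|y_s| < 1/10`, `|x_s − υ| ≤ 0.126`).

Proof (polar/cartesian split). `Log w = −Log(1+z) = −(ℓ + iθ)`, `ℓ = log ‖1+z‖`, `θ = arg(1+z)`; with `z = x + iy`,
`q = ‖1+z‖² = (1+x)² + y²`, the factor `1 + ε(1/4 − w/2)` has real part `A = 1 + ε/4 − ε(1+x)/(2q) ∈ [0, 1 − ε/10]` and imaginary
part `B = εy/(2q)`; so `Im ξ₀ = −(ℓB + θA)`, `Re ξ₀ = −(ℓA − θB)`. Inputs: `|θ| ≤ 3/8` (from `sin θ = y/‖1+z‖`, `|y| ≤ (9/25)‖1+z‖`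
on the disc and `sin(3/8) > 3/8 − (3/8)³/6 > 9/25`, Mathlib `Real.sin_gt_sub_cube`), `|ℓ| ≤ 23/50` (`log(5/4) ≤ 23/100` from
Mathlib `Real.abs_log_sub_add_sum_range_le`), and a case split at `x = −1/5` for the cross term `|ℓ|·|B|`.

WHAT THIS IS NOT: nothing about `ξ` or `ζ`. References: theory g8's S3-BLUEPRINT / line card `line-far-gumbel.md` (item evidence
on `stmt-RiemannHypothesis-19465`); GORZ 2019 [GORZPNAS2019].
-/

noncomputable section
-- D-0017: `Summit.RiemannHypothesis.RiemannHypothesis.…` duplicates the namespace BY DESIGN (single-problem summit).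
set_option linter.dupNamespace false

namespace Summit.RiemannHypothesis.RiemannHypothesis.Theorems.JensenPolynomials.FarGumbel

open Complex

/-- `log(5/4) ≤ 23/100` (true value `0.22314…`; three terms of the series for `log(1 − 1/5)`). -/
theorem log_five_fourths_le : Real.log (5 / 4 : ℝ) ≤ 23 / 100 := by
  have h := Real.abs_log_sub_add_sum_range_le (x := (1 / 5 : ℝ))
    (by rw [abs_of_pos (by norm_num : (0 : ℝ) < 1 / 5)]; norm_num) 2
  rw [abs_of_pos (by norm_num : (0 : ℝ) < 1 / 5)] at h
  simp only [Finset.sum_range_succ, Finset.sum_range_zero] at h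
  norm_num at h
  have h45 : Real.log (4 / 5 : ℝ) = -Real.log (5 / 4) := by
    rw [← Real.log_inv]; norm_num
  rw [h45] at h
  have := (abs_le.1 h).1
  linarith

/-- `|arg(1+z)| ≤ 3/8` for `‖z‖ ≤ 9/25` (true value `arcsin(9/25) = 0.3683…`). -/
theorem abs_arg_one_add_le {z : ℂ} (hz : ‖z‖ ≤ (9 / 25 : ℝ)) : |Complex.arg (1 + z)| ≤ 3 / 8 := by
  have hxabs : |z.re| ≤ 9 / 25 := (abs_re_le_norm z).trans hz
  obtain ⟨hx1, _⟩ := abs_le.1 hxabs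
  have hxy : z.re ^ 2 + z.im ^ 2 ≤ (9 / 25) ^ 2 := by
    have h1 : ‖z‖ ^ 2 = z.re ^ 2 + z.im ^ 2 := by rw [Complex.sq_norm, Complex.normSq_apply]; ring
    rw [← h1]; exact pow_le_pow_left₀ (norm_nonneg _) hz 2
  have hre_pos : 0 < (1 + z).re := by simp; linarith
  have h1z : 1 + z ≠ 0 := fun h => by rw [h] at hre_pos; simp at hre_pos
  have hnorm_pos : 0 < ‖1 + z‖ := norm_pos_iff.2 h1z
  have harg : |Complex.arg (1 + z)| < Real.pi / 2 := Complex.abs_arg_lt_pi_div_two_iff.2 (Or.inl hre_pos)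
  obtain ⟨harg1, harg2⟩ := abs_lt.1 harg
  have hsin : Real.sin (Complex.arg (1 + z)) = z.im / ‖1 + z‖ := by
    rw [Complex.sin_arg]; simp
  -- `|sin θ| ≤ 9/25`
  have hq : ‖1 + z‖ ^ 2 = (1 + z.re) ^ 2 + z.im ^ 2 := by
    rw [Complex.sq_norm, Complex.normSq_apply]; simp; ring
  have hsq : z.im ^ 2 ≤ (9 / 25 * ‖1 + z‖) ^ 2 := by
    rw [mul_pow, hq]; nlinarith [sq_nonneg (z.re + (9 / 25) ^ 2)]
  have hsin_le : |Real.sin (Complex.arg (1 + z))| ≤ 9 / 25 := by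
    rw [hsin, abs_div, abs_of_pos hnorm_pos, div_le_iff₀ hnorm_pos]
    exact abs_le_of_sq_le_sq' hsq (by positivity) |> fun h => abs_le.2 ⟨by linarith [h.1], h.2⟩
  have hs38 : (9 / 25 : ℝ) < Real.sin (3 / 8) := by
    have := Real.sin_gt_sub_cube (show (0 : ℝ) < 3 / 8 by norm_num)
    linarith
  have hpi : (3 / 8 : ℝ) ≤ Real.pi / 2 := by linarith [Real.pi_gt_three]
  rw [abs_le]
  constructor
  · by_contra h
    rw [not_le] at h
    have hlt := Real.sin_lt_sin_of_lt_of_le_pi_div_two (le_of_lt harg1) (by linarith) h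
    rw [Real.sin_neg] at hlt
    have := (abs_le.1 hsin_le).1
    linarith
  · by_contra h
    rw [not_le] at h
    have hlt := Real.sin_lt_sin_of_lt_of_le_pi_div_two (by linarith) (le_of_lt harg2) h
    have := (abs_le.1 hsin_le).2
    linarith

/-- `|log ‖1+z‖| ≤ 23/50` for `‖z‖ ≤ 9/25`, and `|log ‖1+z‖| ≤ 9/25` when moreover `−1/5 ≤ Re z`. -/
theorem abs_log_norm_one_add_le {z : ℂ} (hz : ‖z‖ ≤ (9 / 25 : ℝ)) :
    |Real.log ‖1 + z‖| ≤ 23 / 50 ∧ (-(1 / 5 : ℝ) ≤ z.re → |Real.log ‖1 + z‖| ≤ 9 / 25) := by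
  have hn1 : (16 : ℝ) / 25 ≤ ‖1 + z‖ := by
    have h := norm_sub_le (1 + z) z
    simp only [add_sub_cancel_right, norm_one] at h
    linarith
  have hn2 : ‖1 + z‖ ≤ 34 / 25 := by
    have h := norm_add_le (1 : ℂ) z
    simp only [norm_one] at h
    linarith
  have hnorm_pos : 0 < ‖1 + z‖ := by linarith
  have hup : Real.log ‖1 + z‖ ≤ 9 / 25 := by
    have := Real.log_le_sub_one_of_pos hnorm_pos
    linarith
  have h54 := log_five_fourths_le
  refine ⟨abs_le.2 ⟨?_, by linarith⟩, fun hx => abs_le.2 ⟨?_, by linarith⟩⟩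
  · have hmono : Real.log (16 / 25) ≤ Real.log ‖1 + z‖ := Real.log_le_log (by norm_num) hn1
    have h2 : Real.log (16 / 25 : ℝ) = -(2 * Real.log (5 / 4)) := by
      rw [show (16 / 25 : ℝ) = ((5 / 4) ^ 2)⁻¹ by norm_num, Real.log_inv, Real.log_pow]
      push_cast; ring
    linarith
  · have hre : (4 : ℝ) / 5 ≤ ‖1 + z‖ := by
      have h0 := abs_re_le_norm (1 + z)
      have h' : (1 + z).re = 1 + z.re := by simp
      rw [h'] at h0
      have : |1 + z.re| = 1 + z.re := abs_of_pos (by linarith)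
      linarith
    have hmono : Real.log (4 / 5) ≤ Real.log ‖1 + z‖ := Real.log_le_log (by norm_num) hre
    have h2 : Real.log (4 / 5 : ℝ) = -Real.log (5 / 4) := by
      rw [← Real.log_inv]; norm_num
    linarith

/-- The real and imaginary parts of `ξ₀ = farXi0 (farW z) ε` in coordinates (`‖z‖ < 1`): with `ℓ = log ‖1+z‖`, `θ = arg(1+z)`,
`q = (1 + Re z)² + (Im z)²`, `A = 1 + ε/4 − ε(1 + Re z)/(2q)`, `B = ε·Im z/(2q)`: `Im ξ₀ = −(ℓB + θA)`, `Re ξ₀ = −(ℓA − θB)`. -/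
theorem farXi0_farW_im_re {z : ℂ} (hz : ‖z‖ < 1) (ε : ℝ) :
    (farXi0 (farW z) ε).im =
      -(Real.log ‖1 + z‖ * (ε * (z.im / ((1 + z.re) ^ 2 + z.im ^ 2)) / 2) +
        Complex.arg (1 + z) * (1 + ε / 4 - ε * ((1 + z.re) / ((1 + z.re) ^ 2 + z.im ^ 2)) / 2)) ∧
    (farXi0 (farW z) ε).re =
      -(Real.log ‖1 + z‖ * (1 + ε / 4 - ε * ((1 + z.re) / ((1 + z.re) ^ 2 + z.im ^ 2)) / 2) -
        Complex.arg (1 + z) * (ε * (z.im / ((1 + z.re) ^ 2 + z.im ^ 2)) / 2)) := by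
  -- `1 + z` lies in the slit plane; the formula `ξ₀ = −Log(1+z)·(1 + ε(1/4 − (1+z)⁻¹/2))`
  have hslit : 1 + z ∈ Complex.slitPlane := Complex.mem_slitPlane_of_norm_lt_one hz
  have hxi : farXi0 (farW z) ε = -Complex.log (1 + z) * (1 + (ε : ℂ) * (1 / 4 - (1 + z)⁻¹ / 2)) := by
    have hLw : Complex.log (1 + z)⁻¹ = -Complex.log (1 + z) :=
      Complex.log_inv _ (Complex.slitPlane_arg_ne_pi hslit)
    show Complex.log (1 + z)⁻¹ * (1 + (ε : ℂ) * (1 / 4 - (1 + z)⁻¹ / 2)) = _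
    rw [hLw]
  have hnq : Complex.normSq (1 + z) = (1 + z.re) ^ 2 + z.im ^ 2 := by
    rw [Complex.normSq_apply]; simp; ring
  constructor
  · rw [hxi]
    simp [Complex.mul_im, Complex.mul_re, Complex.log_re, Complex.log_im, hnq]
    ring
  · rw [hxi]
    simp [Complex.mul_im, Complex.mul_re, Complex.log_re, Complex.log_im, hnq]
    ring

set_option maxHeartbeats 400000 in
/-- The real-variable budget behind `|Im ξ₀| ≤ 39/100`: `|ℓB + θA| ≤ |ℓ||B| + |θ|A ≤ 39/100`, with a case split at
`x = −1/5` (`x < −1/5`: `|y| ≤ 3/10`, `A ≤ 1 − ε/4`, `|ℓ| ≤ 23/50`; `x ≥ −1/5`: `q ≥ 16/25`, `|ℓ| ≤ 9/25`, `A ≤ 1 − ε/10`). -/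
theorem xi0_im_budget {x y lr θ ε q : ℝ} (hε : 0 < ε) (hε' : ε ≤ 20 / 189)
    (hxy : x ^ 2 + y ^ 2 ≤ (9 / 25) ^ 2) (hxabs : |x| ≤ 9 / 25) (hyabs : |y| ≤ 9 / 25)
    (hθ : |θ| ≤ 3 / 8) (hlr : |lr| ≤ 23 / 50) (hlr' : -(1 / 5 : ℝ) ≤ x → |lr| ≤ 9 / 25)
    (hq : (1 + x) ^ 2 + y ^ 2 = q) :
    |-(lr * (ε * (y / q) / 2) + θ * (1 + ε / 4 - ε * ((1 + x) / q) / 2))| ≤ 39 / 100 := by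
  obtain ⟨hx1, hx2⟩ := abs_le.1 hxabs
  have hy0 : 0 ≤ |y| := abs_nonneg _
  have hθ0 : 0 ≤ |θ| := abs_nonneg _
  have hlr0 : 0 ≤ |lr| := abs_nonneg _
  -- polynomial facts on the disc (`1 + x ≥ 16/25`, `q = (1+x)² + y²`)
  have hx' : (16 : ℝ) / 25 ≤ 1 + x := by linarith
  have hxx : (16 / 25 : ℝ) * (16 / 25) ≤ (1 + x) * (1 + x) := mul_le_mul hx' hx' (by norm_num) (by linarith)
  have hxx' : (16 / 25 : ℝ) * (1 + x) ≤ (1 + x) * (1 + x) := mul_le_mul_of_nonneg_right hx' (by linarith)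
  have hq_ge : (256 : ℝ) / 625 ≤ q := by rw [← hq]; nlinarith [sq_nonneg y, hxx]
  have hqpos : 0 < q := by linarith
  have hxq1 : (1 + x) / q ≤ 25 / 16 := by rw [div_le_iff₀ hqpos, ← hq]; nlinarith [sq_nonneg y, hxx']
  have hxq2 : 7 / 10 ≤ (1 + x) / q := by rw [le_div_iff₀ hqpos, ← hq]; nlinarith [hxy]
  -- `0 ≤ A ≤ 1 − ε/10`, `|B| = ε|y|/(2q)`
  obtain ⟨A, hA⟩ : ∃ A : ℝ, 1 + ε / 4 - ε * ((1 + x) / q) / 2 = A := ⟨_, rfl⟩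
  obtain ⟨B, hB⟩ : ∃ B : ℝ, ε * (y / q) / 2 = B := ⟨_, rfl⟩
  rw [hA, hB]
  have hA_nn : 0 ≤ A := by
    have : ε * ((1 + x) / q) ≤ ε * (25 / 16) := mul_le_mul_of_nonneg_left hxq1 hε.le
    rw [← hA]; linarith
  have hA_le : A ≤ 1 - ε / 10 := by
    have : ε * (7 / 10) ≤ ε * ((1 + x) / q) := mul_le_mul_of_nonneg_left hxq2 hε.le
    rw [← hA]; linarith
  have hB_abs : |B| = ε * (|y| / q) / 2 := by
    rw [← hB, abs_div, abs_mul, abs_div, abs_of_pos hε, abs_of_pos hqpos, abs_two]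
  have hB0 : 0 ≤ |B| := abs_nonneg _
  rw [abs_neg]
  have key : |lr * B + θ * A| ≤ |lr| * |B| + |θ| * A := by
    calc |lr * B + θ * A| ≤ |lr * B| + |θ * A| := abs_add_le _ _
      _ = |lr| * |B| + |θ| * A := by rw [abs_mul, abs_mul, abs_of_nonneg hA_nn]
  have hθA : |θ| * A ≤ 3 / 8 * A := mul_le_mul_of_nonneg_right hθ hA_nn
  rcases lt_or_ge x (-(1 / 5 : ℝ)) with hx5 | hx5
  · -- `x < −1/5`: `|y| ≤ 3/10`, `A ≤ 1 − ε/4`, `|ℓ| ≤ 23/50`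
    have hy3 : |y| ≤ 3 / 10 := by
      have hx25 : (0 : ℝ) < (-1 / 5 - x) * (1 / 5 - x) := mul_pos (by linarith) (by linarith)
      refine abs_le_of_sq_le_sq ?_ (by norm_num)
      nlinarith [hxy, hx25]
    have hxq3 : 1 ≤ (1 + x) / q := by rw [le_div_iff₀ hqpos, ← hq]; nlinarith [hxy]
    have hA4 : A ≤ 1 - ε / 4 := by
      have : ε * 1 ≤ ε * ((1 + x) / q) := mul_le_mul_of_nonneg_left hxq3 hε.le
      rw [← hA]; linarith
    have hyq' : |y| / q ≤ 3 / 10 * (625 / 256) := by rw [div_le_iff₀ hqpos]; linarith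
    have hB' : |B| ≤ ε * (3 / 10 * (625 / 256)) / 2 := by
      rw [hB_abs]; have := mul_le_mul_of_nonneg_left hyq' hε.le; linarith
    have h1 : |lr| * |B| ≤ 23 / 50 * |B| := mul_le_mul_of_nonneg_right hlr hB0
    have h2 : (3 : ℝ) / 8 * A ≤ 3 / 8 * (1 - ε / 4) := by linarith
    linarith
  · -- `−1/5 ≤ x`: `q ≥ 16/25`, `|ℓ| ≤ 9/25`
    have hlr9 := hlr' hx5
    obtain ⟨_, hy2⟩ := abs_le.1 hyabs
    have hx45 : (4 : ℝ) / 5 ≤ 1 + x := by linarith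
    have hq16 : (16 : ℝ) / 25 ≤ q := by
      rw [← hq]; nlinarith [sq_nonneg y, mul_le_mul hx45 hx45 (by norm_num) (by linarith)]
    have hyq' : |y| / q ≤ 9 / 25 * (25 / 16) := by rw [div_le_iff₀ hqpos]; linarith
    have hB' : |B| ≤ ε * (9 / 25 * (25 / 16)) / 2 := by
      rw [hB_abs]; have := mul_le_mul_of_nonneg_left hyq' hε.le; linarith
    have h1 : |lr| * |B| ≤ 9 / 25 * |B| := mul_le_mul_of_nonneg_right hlr9 hB0
    have h2 : (3 : ℝ) / 8 * A ≤ 3 / 8 * (1 - ε / 10) := by linarith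
    linarith

/-- The real-variable budget behind `|Re ξ₀| ≤ 1/2`: `|ℓA − θB| ≤ |ℓ|A + |θ||B| ≤ 23/50 + (3/8)|B| ≤ 1/2`. -/
theorem xi0_re_budget {x y lr θ ε q : ℝ} (hε : 0 < ε) (hε' : ε ≤ 20 / 189)
    (hxy : x ^ 2 + y ^ 2 ≤ (9 / 25) ^ 2) (hxabs : |x| ≤ 9 / 25) (hyabs : |y| ≤ 9 / 25)
    (hθ : |θ| ≤ 3 / 8) (hlr : |lr| ≤ 23 / 50) (hq : (1 + x) ^ 2 + y ^ 2 = q) :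
    |-(lr * (1 + ε / 4 - ε * ((1 + x) / q) / 2) - θ * (ε * (y / q) / 2))| ≤ 1 / 2 := by
  obtain ⟨hx1, hx2⟩ := abs_le.1 hxabs
  have hy0 : 0 ≤ |y| := abs_nonneg _
  have hθ0 : 0 ≤ |θ| := abs_nonneg _
  have hlr0 : 0 ≤ |lr| := abs_nonneg _
  have hx' : (16 : ℝ) / 25 ≤ 1 + x := by linarith
  have hxx : (16 / 25 : ℝ) * (16 / 25) ≤ (1 + x) * (1 + x) := mul_le_mul hx' hx' (by norm_num) (by linarith)
  have hxx' : (16 / 25 : ℝ) * (1 + x) ≤ (1 + x) * (1 + x) := mul_le_mul_of_nonneg_right hx' (by linarith)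
  have hq_ge : (256 : ℝ) / 625 ≤ q := by rw [← hq]; nlinarith [sq_nonneg y, hxx]
  have hqpos : 0 < q := by linarith
  have hxq1 : (1 + x) / q ≤ 25 / 16 := by rw [div_le_iff₀ hqpos, ← hq]; nlinarith [sq_nonneg y, hxx']
  have hxq2 : 7 / 10 ≤ (1 + x) / q := by rw [le_div_iff₀ hqpos, ← hq]; nlinarith [hxy]
  obtain ⟨A, hA⟩ : ∃ A : ℝ, 1 + ε / 4 - ε * ((1 + x) / q) / 2 = A := ⟨_, rfl⟩
  obtain ⟨B, hB⟩ : ∃ B : ℝ, ε * (y / q) / 2 = B := ⟨_, rfl⟩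
  rw [hA, hB]
  have hA_nn : 0 ≤ A := by
    have : ε * ((1 + x) / q) ≤ ε * (25 / 16) := mul_le_mul_of_nonneg_left hxq1 hε.le
    rw [← hA]; linarith
  have hA_le : A ≤ 1 - ε / 10 := by
    have : ε * (7 / 10) ≤ ε * ((1 + x) / q) := mul_le_mul_of_nonneg_left hxq2 hε.le
    rw [← hA]; linarith
  have hB_abs : |B| = ε * (|y| / q) / 2 := by
    rw [← hB, abs_div, abs_mul, abs_div, abs_of_pos hε, abs_of_pos hqpos, abs_two]
  have hB0 : 0 ≤ |B| := abs_nonneg _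
  rw [abs_neg]
  have key : |lr * A - θ * B| ≤ |lr| * A + |θ| * |B| := by
    calc |lr * A - θ * B| ≤ |lr * A| + |θ * B| := abs_sub _ _
      _ = |lr| * A + |θ| * |B| := by rw [abs_mul, abs_mul, abs_of_nonneg hA_nn]
  have hyq : |y| / q ≤ 9 / 25 * (625 / 256) := by
    rw [div_le_iff₀ hqpos]; linarith
  have hB_le : |B| ≤ ε * (9 / 25 * (625 / 256)) / 2 := by
    rw [hB_abs]; have := mul_le_mul_of_nonneg_left hyq hε.le; linarith
  have h1 : |lr| * A ≤ |lr| * 1 := mul_le_mul_of_nonneg_left (by linarith) hlr0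
  have h2 : |θ| * |B| ≤ 3 / 8 * |B| := mul_le_mul_of_nonneg_right hθ hB0
  linarith

/-- **(L0) GEOMETRY OF ξ₀** (eng-4 g3's S3 WANTED list, name + signature verbatim): `|Im ξ₀| ≤ 0.39`, `|Re ξ₀| ≤ 1/2` on the
disc `‖z̃‖ ≤ 9/25`, `0 < ε ≤ 20/189` (blueprint: `0.3683 / 0.4463`). Gives `|y_s| ≤ 0.0975 + 0.0006 < 1/10` and
`|x_s − υ| ≤ 0.126` in `FarGumbel.laplaceFar_of_wanted`. -/
theorem wanted_xi0_box (z : ℂ) (hz : ‖z‖ ≤ (9 / 25 : ℝ)) (ε : ℝ) (hε : 0 < ε) (hε' : ε ≤ 20 / 189) :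
    |(farXi0 (farW z) ε).im| ≤ 39 / 100 ∧ |(farXi0 (farW z) ε).re| ≤ 1 / 2 := by
  have hz1 : ‖z‖ < 1 := lt_of_le_of_lt hz (by norm_num)
  obtain ⟨him, hre⟩ := farXi0_farW_im_re hz1 ε
  -- the disc and the transcendental inputs, then pass to real variables
  have hxy : z.re ^ 2 + z.im ^ 2 ≤ (9 / 25) ^ 2 := by
    have h1 : ‖z‖ ^ 2 = z.re ^ 2 + z.im ^ 2 := by rw [Complex.sq_norm, Complex.normSq_apply]; ring
    rw [← h1]; exact pow_le_pow_left₀ (norm_nonneg _) hz 2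
  have hxabs : |z.re| ≤ 9 / 25 := (abs_re_le_norm z).trans hz
  have hyabs : |z.im| ≤ 9 / 25 := (abs_im_le_norm z).trans hz
  have hθ : |Complex.arg (1 + z)| ≤ 3 / 8 := abs_arg_one_add_le hz
  obtain ⟨hlr, hlr'⟩ := abs_log_norm_one_add_le hz
  rw [him, hre]
  exact ⟨xi0_im_budget hε hε' hxy hxabs hyabs hθ hlr hlr' rfl, xi0_re_budget hε hε' hxy hxabs hyabs hθ hlr rfl⟩

end Summit.RiemannHypothesis.RiemannHypothesis.Theorems.JensenPolynomials.FarGumbel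

end
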